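import Mathlib
import Summits.Ventures.HodgeRepro.Tier4.Common.AdelicDefs
import Summits.Ventures.HodgeRepro.Tier4.Common.CongruenceAdeles
import Summits.Ventures.HodgeRepro.Tier4.Common.CompactOpenLevel
import Summits.Ventures.HodgeRepro.Tier4.Common.RowWeights
import Summits.Ventures.HodgeRepro.Tier4.Line1.AdelicParts
import Summits.Ventures.HodgeRepro.Tier4.Line1.FiniteLevelIsolation
import Summits.Ventures.HodgeRepro.Tier4.Line4.LevelCosetCongruence
import Summits.Ventures.HodgeRepro.Tier4.Line4.IntegerArchBound
import Summits.Ventures.HodgeRepro.Tier4.Line4.L1ClassV3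
import Summits.Ventures.HodgeRepro.Tier4.Line4.ArchDistBounds
import Summits.Ventures.HodgeRepro.Tier4.Line4.ArchDistLower

/-!
# Tier4/Line4/FinitePartCongruence — THE SPARSE COSET IN ITS HONEST SHAPE: a statement about FINITE PARTS

Blind re-derivation cell `pub-hodge-repro`, Tier 4 «prove the step» (README §9–§10), seat t4-L1-p3 (gen 4).
Tree path `lean/Summits/Ventures/HodgeRepro/Tier4/Line4/FinitePartCongruence.lean`.

THE DEFECT (LevelKVacuity, kernel-certified): `K(N) = levelK W N` has archimedean component `1`, so a RATIONAL
`κ γ₀ κ'` with `κ, κ' ∈ K(N)` equals `γ₀` (`levelK_mul_eq_of_mem_rationalPoints`).  LevelCosetCongruence (D)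
`entry_sub_mem_N_smul_of_mem_levelK_mul`, IntegerArchBound's `exists_infinitePlace_natCast_le_entry` and
ArchDistLower (6)/(7) `exists_infinitePlace_natCast_sub_le_archSizeAt` / `log_max_one_le_archDist_of_levelK(')`
are therefore TRUE BUT CONTENTLESS as typed (`m = m₀`, `z = 0`; the binder `hne : κ * γ₀ * κ' ≠ γ₀` is never
satisfiable together with `hγ`).  They stay on the tree as true statements; nothing should bind them.

THE REPAIR.  The sparse coset is a statement about finite parts: a rational `γ` whose FINITE part lies in
`K(N) γ₀ K(N)` — typed as `GA.ofFinPart W γ = κ * GA.ofFinPart W γ₀ * κ'` (FiniteLevelIsolation's `ofFinPart`: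
the element with the finite part of `γ` and archimedean part `1`) — has `k`-entries congruent to those of `γ₀`
modulo `N 𝓞_k` (`entry_sub_mem_N_smul_of_ofFinPart_eq`), because the finite-part half of the principal-adele
argument (`exists_eq_N_mul_of_finPart_algebraMap_mem_modSet`) needs no archimedean clause; and `γ ≠ γ₀` is now a
GENUINE hypothesis (same finite coset, different archimedean parts — the lattice points of the sparse coset),
giving the read-out `log (max 1 (N − B)) ≤ archDist W γ` (`log_max_one_le_archDist_of_ofFinPart_eq`) at some
infinite place, `B` bounding the entries of `γ₀`.  The consumers ((S1) of C-L4-TAIL) bind THESE names.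
No printed input.  HC_CM is NOT proved by anyone in this repository.
-/

namespace Summit.Ventures.HodgeRepro.Tier4.Line4

open Summit.Ventures.HodgeRepro.Tier4.Common Summit.Ventures.HodgeRepro.Tier4.Line1 NumberField
  IsDedekindDomain Matrix
open scoped NumberField

section Principal

variable {k : Type} [Field k] [NumberField k]

/-- **(A) The finite-part half of the principal-adele argument**: an element of `k` whose finite part lies in
`N · ∏_v 𝓞_v` is `N` times an integer of `k` (no archimedean clause). -/
theorem exists_eq_N_mul_of_finPart_algebraMap_mem_modSet {N : ℕ} (hN : N ≠ 0) {x : k}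
    (hx : finPart k (algebraMap k (Ad k) x) ∈ modSet k N) :
    ∃ z : 𝓞 k, x = (N : k) * algebraMap (𝓞 k) k z := by
  have hNk : (N : k) ≠ 0 := Nat.cast_ne_zero.mpr hN
  have hval : ∀ v : HeightOneSpectrum (𝓞 k), v.valuation k (x / (N : k)) ≤ 1 := by
    intro v
    have h1 := hx v
    have h2 : Valued.v ((finPart k (algebraMap k (Ad k) x)) v) = v.valuation k x := by
      show Valued.v ((algebraMap k (FiniteAdeleRing (𝓞 k) k) x) v) = _
      rw [FiniteAdeleRing.algebraMap_apply, HeightOneSpectrum.valuedAdicCompletion_eq_valuation']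
    have h3 : natSize k v N = v.valuation k (N : k) := by
      unfold natSize
      rw [HeightOneSpectrum.valuedAdicCompletion_eq_valuation']
    rw [h2, h3] at h1
    have hN0 : v.valuation k (N : k) ≠ 0 := (Valuation.ne_zero_iff _).mpr hNk
    rw [Valuation.map_div, div_le_one₀ (zero_lt_iff.mpr hN0)]
    exact h1
  obtain ⟨z, hz⟩ := HeightOneSpectrum.mem_integers_of_valuation_le_one k (x / (N : k)) hval
  refine ⟨z, ?_⟩
  rw [hz, mul_div_cancel₀ x hNk]

end Principal

section Coset

variable {k : Type} [Field k] [NumberField k] (W : PlaneData k)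

/-- The finite part of the matrix of `ofFinPart x` is the finite part of the matrix of `x`. -/
theorem finM_mat_ofFinPart (x : GA W) : finM k (GA.mat W (GA.ofFinPart W x)) = finM k (GA.mat W x) := by
  rw [GA.mat_ofFinPart, finM_mixM]

/-- Entrywise: `finPart` of an entry of `ofFinPart x` is `finPart` of the entry of `x`. -/
theorem finPart_mat_ofFinPart_apply (x : GA W) (i j : Fin 4) :
    finPart k (GA.mat W (GA.ofFinPart W x) i j) = finPart k (GA.mat W x i j) := by
  have h := congrFun (congrFun (finM_mat_ofFinPart W x) i) j
  simpa only [finM, Matrix.map_apply] using h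

/-- `ofFinPart` preserves finite-integrality. -/
theorem IsIntegralFin.ofFinPart {x : GA W} (hx : IsIntegralFin W x) : IsIntegralFin W (GA.ofFinPart W x) := by
  intro i j
  rw [finPart_mat_ofFinPart_apply]
  exact hx i j

/-- **(B) THE SPARSE COSET IN `k`, finite-part form**: for rational `γ, γ₀` with `γ₀` finite-integral and the finite
part of `γ` in `K(N) γ₀ K(N)` — `GA.ofFinPart W γ = κ * GA.ofFinPart W γ₀ * κ'`, `κ, κ' ∈ K(N)` — the `k`-matrices
`m, m₀` of `γ, γ₀` satisfy `m i j − m₀ i j ∈ N · 𝓞_k` for every entry. -/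
theorem entry_sub_mem_N_smul_of_ofFinPart_eq {N : ℕ} (hN : N ≠ 0) {κ κ' γ γ₀ : GA W}
    (hκ : κ ∈ levelK W N) (hκ' : κ' ∈ levelK W N) (hγ₀ : γ₀ ∈ rationalPoints W)
    (hint : IsIntegralFin W γ₀) (hγ : γ ∈ rationalPoints W)
    (hcos : GA.ofFinPart W γ = κ * GA.ofFinPart W γ₀ * κ') :
    ∃ m m₀ : Matrix (Fin 4) (Fin 4) k, GA.mat W γ = m.map (algebraMap k (Ad k)) ∧
      GA.mat W γ₀ = m₀.map (algebraMap k (Ad k)) ∧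
      ∀ i j, ∃ z : 𝓞 k, m i j - m₀ i j = (N : k) * algebraMap (𝓞 k) k z := by
  obtain ⟨m, hm⟩ := exists_rational_mat_of_mem_rationalPoints W hγ
  obtain ⟨m₀, hm₀⟩ := exists_rational_mat_of_mem_rationalPoints W hγ₀
  refine ⟨m, m₀, hm, hm₀, fun i j => ?_⟩
  have hc := (mat_sub_mem_congrSet_of_mem_levelK W hκ hκ' (IsIntegralFin.ofFinPart W hint) i j).2
  rw [← hcos, Matrix.sub_apply, map_sub, finPart_mat_ofFinPart_apply, finPart_mat_ofFinPart_apply,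
    hm, hm₀, Matrix.map_apply, Matrix.map_apply, ← map_sub, ← map_sub] at hc
  exact exists_eq_N_mul_of_finPart_algebraMap_mem_modSet hN hc

/-- **(C) THE ARCHIMEDEAN READ-OUT, finite-part form**: under (B) and `γ ≠ γ₀`, some infinite place `w` and entry
`(i, j)` satisfy `N − ‖(γ₀)ᵢⱼ‖_w ≤ archSizeAt W w γ`. -/
theorem exists_infinitePlace_natCast_sub_le_archSizeAt_of_ofFinPart_eq {N : ℕ} (hN : N ≠ 0)
    {κ κ' γ γ₀ : GA W} (hκ : κ ∈ levelK W N) (hκ' : κ' ∈ levelK W N) (hγ₀ : γ₀ ∈ rationalPoints W)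
    (hint : IsIntegralFin W γ₀) (hγ : γ ∈ rationalPoints W)
    (hcos : GA.ofFinPart W γ = κ * GA.ofFinPart W γ₀ * κ') (hne : γ ≠ γ₀) :
    ∃ w : InfinitePlace k, ∃ i j : Fin 4,
      (N : ℝ) - ‖Common.adToC w (GA.mat W γ₀ i j)‖ ≤ L1Class.archSizeAt W w γ := by
  obtain ⟨m, m₀, hm, hm₀, hd⟩ := entry_sub_mem_N_smul_of_ofFinPart_eq W hN hκ hκ' hγ₀ hint hγ hcos
  have hex : ∃ i j, m i j ≠ m₀ i j := by
    by_contra hcon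
    simp only [not_exists, ne_eq, not_not] at hcon
    apply hne
    apply L1Class.GA.mat_injective W
    rw [hm, hm₀]
    congr 1
    ext i j
    exact hcon i j
  obtain ⟨i, j, hij⟩ := hex
  obtain ⟨z, hz⟩ := hd i j
  have hz0 : z ≠ 0 := by
    intro h0
    apply hij
    rw [h0, map_zero, mul_zero, sub_eq_zero] at hz
    exact hz
  obtain ⟨w, hw⟩ := exists_infinitePlace_natCast_le_of_sub_eq hz0 hz
  refine ⟨w, i, j, ?_⟩
  have h1 := L1Class.InfinitePlace.apply_sub_le w (m i j) (m₀ i j)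
  have h2 := L1Class.apply_le_archSizeAt_of_mat_eq W hm w i j
  have h3 : ‖Common.adToC w (GA.mat W γ₀ i j)‖ = w (m₀ i j) := by
    rw [hm₀, Matrix.map_apply, L1Class.norm_adToC_algebraMap]
  rw [h3]
  linarith

/-- **(D) THE (S1) SHAPE, finite-part form**: with `B` bounding every entry of `γ₀` at every infinite place,
`log (max 1 (N − B)) ≤ archDist W γ` for rational `γ ≠ γ₀` whose finite part lies in `K(N) γ₀ K(N)`. -/
theorem log_max_one_le_archDist_of_ofFinPart_eq {N : ℕ} (hN : N ≠ 0) {κ κ' γ γ₀ : GA W}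
    (hκ : κ ∈ levelK W N) (hκ' : κ' ∈ levelK W N) (hγ₀ : γ₀ ∈ rationalPoints W)
    (hint : IsIntegralFin W γ₀) (hγ : γ ∈ rationalPoints W)
    (hcos : GA.ofFinPart W γ = κ * GA.ofFinPart W γ₀ * κ') (hne : γ ≠ γ₀)
    {B : ℝ} (hB : ∀ (w : InfinitePlace k) (i j : Fin 4), ‖Common.adToC w (GA.mat W γ₀ i j)‖ ≤ B) :
    Real.log (max 1 ((N : ℝ) - B)) ≤ L1Class.archDist W γ := by
  obtain ⟨w, i, j, hw⟩ :=
    exists_infinitePlace_natCast_sub_le_archSizeAt_of_ofFinPart_eq W hN hκ hκ' hγ₀ hint hγ hcos hne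
  have h := hB w i j
  exact L1Class.log_max_one_le_archDist_of_le_archSizeAt W (by linarith)

/-- The same with the explicit bound `B = ∑_w archSizeAt W w γ₀`. -/
theorem log_max_one_le_archDist_of_ofFinPart_eq' {N : ℕ} (hN : N ≠ 0) {κ κ' γ γ₀ : GA W}
    (hκ : κ ∈ levelK W N) (hκ' : κ' ∈ levelK W N) (hγ₀ : γ₀ ∈ rationalPoints W)
    (hint : IsIntegralFin W γ₀) (hγ : γ ∈ rationalPoints W)
    (hcos : GA.ofFinPart W γ = κ * GA.ofFinPart W γ₀ * κ') (hne : γ ≠ γ₀) :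
    Real.log (max 1 ((N : ℝ) - ∑ w : InfinitePlace k, L1Class.archSizeAt W w γ₀)) ≤
      L1Class.archDist W γ := by
  refine log_max_one_le_archDist_of_ofFinPart_eq W hN hκ hκ' hγ₀ hint hγ hcos hne fun w i j => ?_
  refine (L1Class.norm_entry_le_archSizeAt W w γ₀ i j).trans ?_
  exact Finset.single_le_sum (f := fun w' => L1Class.archSizeAt W w' γ₀)
    (fun w' _ => L1Class.archSizeAt_nonneg W w' γ₀) (Finset.mem_univ w)

end Coset

end Summit.Ventures.HodgeRepro.Tier4.Line4
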